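import Literature.NumberTheory.GaloisCohomology.Howard2004.SelmerTriples
import HarnessLib

/-!
# Howard 2004, Hypothesis H.5(a): the `τ`-eigenlines of a rank-two residual representation

`Proofs` file (theorems only; no definition, no named fact, no `sorry`) for the typed hypothesis
`Literature.NumberTheory.GaloisCohomology.Howard2004.H5a` of `Howard2004/SelmerTriples.lean` ((W9)-A):
«the action of `τ` splits `T̄ = T̄⁺ ⊕ T̄⁻` into one-dimensional eigenspaces» (B. Howard, *The Heegner
point Kolyvagin system*, Compositio Math. 140 (2004), §1.3 H.5(a); arXiv:1202.6340 p. 7, L93–95), typed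
as `H5a A := ∃ xp ≠ 0, θ xp = xp ∧ ∃ xm ≠ 0, θ xm = -xm ∧ ∀ x, ∃ a b : R, x = a • xp + b • xm` for the
residual `G_ℚ`-structure `A : ResidualTau cd ρbar` (`θ = A.θ`, the action of `τ` on `T̄`).

GENERIC DISCHARGE: the statement is pure linear algebra on the residual module and holds for EVERY
residual presentation which is a plane over the residue field `k = R/𝔪` of ODD characteristic, as soon as
`θ` is neither `id` nor `-id` — in the application `T̄ = E[p]`, `p` odd, this is «`det θ = -1`», which is
itself forced by the residual Weil pairing (`e(s^τ, t^τ) = -e(s, t)`, Howard's H.5(c) sign; Jetchev 2008,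
§3.2 (2): «The existence of the Weil pairing implies that `E[p^m]` splits into two eigenspaces of complex
conjugation each of which is free of rank one»). Contents:

* §1 (field level) `exists_eigenlines_of_involutive`: `k` a field with `(2 : k) ≠ 0`, `finrank k V = 2`,
  `θ` a `k`-linear involution, `θ ≠ id`, `θ ≠ -id` ⇒ non-zero `θ`-fixed `xp` and `θ`-anti-fixed `xm` with
  `V = k xp + k xm`; `ne_id_and_ne_neg_id_of_pairing_neg`: `θ ≠ ±id` from a non-zero bi-additive form
  with `e (θ s) (θ t) = - e s t`.
* §2 (Howard's shape) `Howard2004.h5a_of_ne_of_finrank_eq_two`: for `A : ResidualTau cd ρbar` on a residual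
  module `Nbar` on which `R` acts through a surjection `φ : R →+* k` onto a field (`r • x = φ r • x`; e.g.
  `R/𝔪`, or `ZMod p` for the level rings `A_{m,k}`), `finrank k Nbar = 2`, `(2 : k) ≠ 0`, `A.θ ≠ ±id` ⇒
  `H5a A` (scalars lifted along `φ`); `h5a_of_ne_of_finrank_residueField_eq_two` (the `R/𝔪` scalar-tower
  form) and `Howard2004.h5a_of_pairing_neg` (the Weil-pairing route).

Cell `pub/bsd-print-x9` (rows 9/10, shared μ-item; v9 STUB 1a); seat `bsd-line-x10b-p2` LEAD g5. No summit
statement is proved; BSD is not proved by any of this.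
-/

noncomputable section

namespace Literature.NumberTheory.GaloisCohomology.Howard2004

/-! ## §1 Field level: eigenlines of an involution on a plane in odd characteristic -/

section Field

variable {k : Type*} [Field k] {V : Type*} [AddCommGroup V] [Module k V]

/-- **Eigenlines of an involution on a plane** (`char k ≠ 2`): if `θ² = 1`, `θ ≠ 1`, `θ ≠ -1` on a
two-dimensional `k`-space, then there are non-zero `xp`, `xm` with `θ xp = xp`, `θ xm = -xm`, and every
vector is `a • xp + b • xm` — «`τ` splits `T̄ = T̄⁺ ⊕ T̄⁻` into one-dimensional eigenspaces».
[cite: Howard2004HeegnerKolyvagin, H.5(a) (arXiv:1202.6340 p. 7, L93–95)] -/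
theorem exists_eigenlines_of_involutive (h2 : (2 : k) ≠ 0) (hdim : Module.finrank k V = 2)
    (θ : V →ₗ[k] V) (hθ : ∀ x, θ (θ x) = x) (hne : θ ≠ LinearMap.id) (hne' : θ ≠ -LinearMap.id) :
    ∃ xp : V, xp ≠ 0 ∧ θ xp = xp ∧ ∃ xm : V, xm ≠ 0 ∧ θ xm = -xm ∧
      ∀ x : V, ∃ a b : k, x = a • xp + b • xm := by
  -- a `θ`-fixed vector `xp = y + θ y` (from `θ ≠ -id`) and an anti-fixed `xm = z - θ z` (from `θ ≠ id`)
  obtain ⟨y, hy⟩ : ∃ y : V, θ y ≠ -y := by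
    by_contra h
    push Not at h
    exact hne' (LinearMap.ext fun x => by rw [h x]; rfl)
  obtain ⟨z, hz⟩ : ∃ z : V, θ z ≠ z := by
    by_contra h
    push Not at h
    exact hne (LinearMap.ext fun x => by rw [h x]; rfl)
  set xp : V := y + θ y with hxp_def
  set xm : V := z - θ z with hxm_def
  have hxp : θ xp = xp := by rw [hxp_def, map_add, hθ, add_comm]
  have hxm : θ xm = -xm := by rw [hxm_def, map_sub, hθ, neg_sub]
  have hxp0 : xp ≠ 0 := by
    intro h0
    apply hy
    rw [hxp_def] at h0
    exact eq_neg_of_add_eq_zero_right h0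
  have hxm0 : xm ≠ 0 := by
    intro h0
    apply hz
    rw [hxm_def, sub_eq_zero] at h0
    exact h0.symm
  -- independence (uses `2 ≠ 0`) and spanning (card = finrank)
  have hli : LinearIndependent k ![xp, xm] := by
    rw [LinearIndependent.pair_iff]
    intro s t hst
    have hst' : s • xp - t • xm = 0 := by
      have := congrArg θ hst
      rw [map_add, map_smul, map_smul, hxp, hxm, map_zero, smul_neg, ← sub_eq_add_neg] at this
      exact this
    have hs2 : (2 : k) • (s • xp) = 0 := by
      rw [two_smul]
      calc s • xp + s • xp = (s • xp + t • xm) + (s • xp - t • xm) := by abel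
        _ = 0 := by rw [hst, hst', add_zero]
    have hs : s = 0 := by
      rw [smul_smul] at hs2
      rcases smul_eq_zero.mp hs2 with h | h
      · exact (mul_eq_zero.mp h).resolve_left h2
      · exact absurd h hxp0
    refine ⟨hs, ?_⟩
    rw [hs, zero_smul, zero_add] at hst
    rcases smul_eq_zero.mp hst with h | h
    · exact h
    · exact absurd h hxm0
  haveI : Module.Finite k V := Module.finite_of_finrank_eq_succ hdim
  have hcard : Fintype.card (Fin 2) = Module.finrank k V := by rw [Fintype.card_fin, hdim]
  let B : Module.Basis (Fin 2) k V := basisOfLinearIndependentOfCardEqFinrank hli hcard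
  have hB : ⇑B = ![xp, xm] := coe_basisOfLinearIndependentOfCardEqFinrank hli hcard
  refine ⟨xp, hxp0, hxp, xm, hxm0, hxm, fun x => ⟨B.repr x 0, B.repr x 1, ?_⟩⟩
  have hsum := B.sum_repr x
  rw [Fin.sum_univ_two, hB] at hsum
  simpa using hsum.symm

end Field

section Pairing

variable {S : Type*} [Ring S] {V : Type*} [AddCommGroup V] [Module S V]

/-- **`θ ≠ ±id` from the residual pairing** (the Weil-pairing route to H.5(a), Howard's H.5(c) sign):
if a bi-additive form `e` on `V` satisfies `e (θ s) (θ t) = - e s t` for all `s, t` and takes some value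
with `e s₀ t₀ + e s₀ t₀ ≠ 0` (automatic for a non-zero value in odd characteristic), then `θ ≠ id` and
`θ ≠ -id`.
[cite: Howard2004HeegnerKolyvagin, H.5(a) and H.5(c) (arXiv:1202.6340 p. 7, L93–p. 8, L1)]
[cite: Jetchev2008, §3.2 (2) (arXiv:math/0703431 p. 10)] -/
theorem ne_id_and_ne_neg_id_of_pairing_neg {P : Type*} [AddCommGroup P] (θ : V →ₗ[S] V)
    (e : V →+ V →+ P) (he : ∀ s t, e (θ s) (θ t) = -e s t) (s₀ t₀ : V)
    (h0 : e s₀ t₀ + e s₀ t₀ ≠ 0) : θ ≠ LinearMap.id ∧ θ ≠ -LinearMap.id := by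
  constructor
  · intro h
    apply h0
    have := he s₀ t₀
    rw [h, LinearMap.id_apply, LinearMap.id_apply] at this
    rw [eq_neg_iff_add_eq_zero] at this
    exact this
  · intro h
    apply h0
    have := he s₀ t₀
    rw [h, LinearMap.neg_apply, LinearMap.neg_apply, LinearMap.id_apply, LinearMap.id_apply,
      map_neg, map_neg, AddMonoidHom.neg_apply, neg_neg] at this
    rw [eq_neg_iff_add_eq_zero] at this
    exact this

end Pairing

/-! ## §2 Howard's shape: `H5a A` for a residual presentation of rank two at odd residue characteristic -/

section Howard

variable {K : Type} [Field K] [NumberField K] {R : Type} [CommRing R]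
  {cd : ConjugationDatum K} {Nbar : Type} [AddCommGroup Nbar] [TopologicalSpace Nbar]
  [DiscreteTopology Nbar] [Module R Nbar] {ρbar : GaloisRepresentations.DiscreteGaloisModule K Nbar}

/-- **H.5(a) holds for every residual presentation which is a PLANE over a field `k` of ODD
characteristic through which `R` acts, as soon as `τ` acts neither as `id` nor as `-id`.** Here the
coefficient ring `R` acts on `T̄` through a ring surjection `φ : R → k` onto a field (`r • x = φ r • x`;
e.g. `k = R/𝔪`, or `k = ZMod p` for the level rings `A_{m,k} ↠ 𝔽_p` of the Eisenstein tower),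
`finrank_k T̄ = 2` and `(2 : k) ≠ 0`; the conclusion is the typed `H5a A` (coefficients in `R`, lifted along
`φ`). In the application `T̄_𝔮 = E[p] ⊗ S_𝔮/𝔪 ≅ E[p]` (Howard 2004 Prop. 2.1.3 proof: «H.5 follows from the
isomorphism `T̄_𝔭 ≅ E[p] ⊗ S_𝔭/𝔪` with `G_K` acting trivially on the second factor»), `p` odd, `det θ̄ = -1`.
[cite: Howard2004HeegnerKolyvagin, H.5(a) (arXiv:1202.6340 p. 7, L93–95) and Prop. 2.1.3 proof (arXiv p. 16, L4–6)] -/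
theorem h5a_of_ne_of_finrank_eq_two {k : Type*} [Field k] [Module k Nbar] (φ : R →+* k)
    (hφ : Function.Surjective φ) (hsmul : ∀ (r : R) (x : Nbar), r • x = φ r • x)
    (A : ResidualTau (R := R) cd ρbar) (h2 : (2 : k) ≠ 0) (hdim : Module.finrank k Nbar = 2)
    (hne : A.θ ≠ LinearMap.id) (hne' : A.θ ≠ -LinearMap.id) : H5a A := by
  -- `θ` is `k`-linear (scalars lift along the surjection `φ`)
  let θk : Nbar →ₗ[k] Nbar :=
    { toFun := A.θ
      map_add' := map_add A.θ
      map_smul' := fun c x => by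
        obtain ⟨r, rfl⟩ := hφ c
        rw [RingHom.id_apply, ← hsmul, ← hsmul, map_smul] }
  have hθk : ∀ x, θk x = A.θ x := fun _ => rfl
  have hkne : θk ≠ LinearMap.id := by
    intro h; apply hne; exact LinearMap.ext fun x => by rw [← hθk, h]; rfl
  have hkne' : θk ≠ -LinearMap.id := by
    intro h; apply hne'; exact LinearMap.ext fun x => by rw [← hθk, h]; rfl
  obtain ⟨xp, hxp0, hxp, xm, hxm0, hxm, hspan⟩ :=
    exists_eigenlines_of_involutive h2 hdim θk (fun x => A.involutive x) hkne hkne'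
  refine ⟨xp, hxp0, hxp, xm, hxm0, hxm, fun x => ?_⟩
  obtain ⟨a, b, hab⟩ := hspan x
  obtain ⟨ra, rfl⟩ := hφ a
  obtain ⟨rb, rfl⟩ := hφ b
  exact ⟨ra, rb, by rw [hab, hsmul, hsmul]⟩

/-- **H.5(a) over the residue field**: the case `k = R/𝔪`, `φ = IsLocalRing.residue R`, `R` acting on `T̄`
through `k` as a scalar tower. [cite: Howard2004HeegnerKolyvagin, H.5(a) (arXiv:1202.6340 p. 7, L93–95)] -/
theorem h5a_of_ne_of_finrank_residueField_eq_two [IsLocalRing R]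
    [Module (IsLocalRing.ResidueField R) Nbar] [IsScalarTower R (IsLocalRing.ResidueField R) Nbar]
    (A : ResidualTau (R := R) cd ρbar)
    (h2 : (2 : IsLocalRing.ResidueField R) ≠ 0)
    (hdim : Module.finrank (IsLocalRing.ResidueField R) Nbar = 2)
    (hne : A.θ ≠ LinearMap.id) (hne' : A.θ ≠ -LinearMap.id) : H5a A :=
  h5a_of_ne_of_finrank_eq_two (IsLocalRing.residue R) IsLocalRing.residue_surjective
    (fun r x => by rw [← IsLocalRing.ResidueField.algebraMap_eq, algebraMap_smul]) A h2 hdim hne hne'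

/-- **H.5(a) from the residual pairing** (the Weil-pairing route): on a residual plane over a field `k` of odd
characteristic through which `R` acts, if some bi-additive form `e` into a group satisfies
`e (θ s) (θ t) = -e s t` (H.5(c)'s sign) and takes a value with `e s₀ t₀ + e s₀ t₀ ≠ 0`, then `H5a A`.
[cite: Howard2004HeegnerKolyvagin, H.5(a), H.5(c) (arXiv:1202.6340 p. 7, L93 – p. 8, L1)]
[cite: Jetchev2008, §3.2 (2) (arXiv:math/0703431 p. 10)] -/
theorem h5a_of_pairing_neg {k : Type*} [Field k] [Module k Nbar] (φ : R →+* k)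
    (hφ : Function.Surjective φ) (hsmul : ∀ (r : R) (x : Nbar), r • x = φ r • x)
    (A : ResidualTau (R := R) cd ρbar) (h2 : (2 : k) ≠ 0) (hdim : Module.finrank k Nbar = 2)
    {P : Type*} [AddCommGroup P] (e : Nbar →+ Nbar →+ P) (he : ∀ s t, e (A.θ s) (A.θ t) = -e s t)
    (s₀ t₀ : Nbar) (h0 : e s₀ t₀ + e s₀ t₀ ≠ 0) : H5a A := by
  obtain ⟨hne, hne'⟩ := ne_id_and_ne_neg_id_of_pairing_neg A.θ e he s₀ t₀ h0
  exact h5a_of_ne_of_finrank_eq_two φ hφ hsmul A h2 hdim hne hne'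

end Howard

end Literature.NumberTheory.GaloisCohomology.Howard2004

end
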